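import Mathlib
import Summits.MatrixMultiplication.MatrixMultiplication.Theorems.ThinBlockAlphaThinPackingsOrbitCriterion
import Summits.MatrixMultiplication.MatrixMultiplication.Theorems.ThinBlockAlphaThinPackingsOrbitStubPacking

set_option linter.dupNamespace false

/-!
# Orbit designs for `ThinPackings`: sizes of the saturated difference sets (stub `stub_orbitLegCard`)

Line `automorphism-orbit-twisted-templates` (skeleton `Ideator4Sketch`) of crux
`ThinBlockAlpha.ThinPackings` (stmt-MatrixMultiplication-10595); lemma F6 of the Fourier cap.

For an orbit design — a finite group `Γ` acting on a finite abelian `H` by additive automorphisms and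
a template `(A, B, C)` that is TPP (`TemplateTPP`) and `Γ`-twisted sum-free (`TwistedSumFree`) — the
`Γ`-saturated difference sets `X = {g • (a − b)}`, `Y = {g • (b − c)}`, `Z = {g • (c − a)}` have
exactly `|Γ|·|A|·|B|`, `|Γ|·|B|·|C|`, `|Γ|·|C|·|A|` elements: the map `(g, s, t) ↦ g • (s − t)` is
injective on `Γ × S × T` (TPP on a fixed `g`; across two different `g`'s the disjointness of
`g • (S − T)` and `S − T` from the landed packing stub), and the `(C, A)` leg is the `(A, C)` leg read
through `g • (c − a) = −(g • (a − c))`.  Every such saturated image is `Γ`-invariant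
(`g • (k • d) = (g k) • d`).
-/

namespace Summit.MatrixMultiplication.MatrixMultiplication.Theorems.ThinPackings.Orbit

open Finset
open scoped Pointwise

section InjOn

variable {Γ H : Type} [Group Γ] [Fintype Γ] [AddCommGroup H] [DecidableEq H]
  [DistribMulAction Γ H]

/-- If every `g ≠ 1` moves `S − T` off itself and subtraction is injective on `S × T`, then
`(g, s, t) ↦ g • (s − t)` is injective on `Γ × S × T` (the argument inside the landed
`card_mul_card_mul_card_le`, as a standalone statement). -/
theorem injOn_smul_sub (S T : Finset H)
    (hdisj : ∀ g : Γ, g ≠ 1 → Disjoint ((S - T).image fun x => g • x) (S - T))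
    (hinj : ∀ s ∈ S, ∀ t ∈ T, ∀ s' ∈ S, ∀ t' ∈ T, s - t = s' - t' → s = s' ∧ t = t') :
    Set.InjOn (fun p : Γ × H × H => p.1 • (p.2.1 - p.2.2))
      ↑((univ : Finset Γ) ×ˢ (S ×ˢ T)) := by
  rintro ⟨g, s, t⟩ hp ⟨g', s', t'⟩ hq hpq
  simp only [mem_coe, mem_product, mem_univ, true_and] at hp hq
  simp only at hpq
  by_cases hg : g = g'
  · subst hg
    obtain ⟨rfl, rfl⟩ := hinj s hp.1 t hp.2 s' hq.1 t' hq.2 (MulAction.injective g hpq)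
    rfl
  · exfalso
    have hne : g'⁻¹ * g ≠ 1 := fun h => hg (inv_mul_eq_one.1 h).symm
    have hmem : (g'⁻¹ * g) • (s - t) ∈ (S - T).image fun x => (g'⁻¹ * g) • x :=
      mem_image_of_mem _ (Finset.sub_mem_sub hp.1 hp.2)
    have hmem' : (g'⁻¹ * g) • (s - t) ∈ S - T := by
      rw [mul_smul, hpq, inv_smul_smul]
      exact Finset.sub_mem_sub hq.1 hq.2
    exact Finset.disjoint_left.1 (hdisj _ hne) hmem hmem'

omit [DecidableEq H] in
/-- Injectivity of `(g, s, t) ↦ g • (s − t)` on `Γ × S × T` transfers to `Γ × T × S`, since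
`g • (t − s) = −(g • (s − t))`. -/
theorem injOn_smul_sub_swap (S T : Finset H)
    (h : Set.InjOn (fun p : Γ × H × H => p.1 • (p.2.1 - p.2.2))
      ↑((univ : Finset Γ) ×ˢ (S ×ˢ T))) :
    Set.InjOn (fun p : Γ × H × H => p.1 • (p.2.1 - p.2.2))
      ↑((univ : Finset Γ) ×ˢ (T ×ˢ S)) := by
  rintro ⟨g, t, s⟩ hp ⟨g', t', s'⟩ hq hpq
  simp only [mem_coe, mem_product, mem_univ, true_and] at hp hq
  simp only at hpq
  have hpq' : g • (s - t) = g' • (s' - t') := by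
    rw [← neg_sub t s, ← neg_sub t' s', smul_neg, smul_neg, hpq]
  have hm : ((g, s, t) : Γ × H × H) ∈ (↑((univ : Finset Γ) ×ˢ (S ×ˢ T)) : Set (Γ × H × H)) := by
    simp only [mem_coe, mem_product, mem_univ, true_and]
    exact ⟨hp.2, hp.1⟩
  have hm' : ((g', s', t') : Γ × H × H) ∈ (↑((univ : Finset Γ) ×ˢ (S ×ˢ T)) : Set (Γ × H × H)) := by
    simp only [mem_coe, mem_product, mem_univ, true_and]
    exact ⟨hq.2, hq.1⟩
  have key := h hm hm' hpq'
  simp only [Prod.mk.injEq] at key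
  obtain ⟨rfl, rfl, rfl⟩ := key
  rfl

/-- When `(g, s, t) ↦ g • (s − t)` is injective on `Γ × S × T`, the saturated difference set
`{g • (s − t)}` has exactly `|Γ|·|S|·|T|` elements. -/
theorem card_image_smul_sub (S T : Finset H)
    (h : Set.InjOn (fun p : Γ × H × H => p.1 • (p.2.1 - p.2.2))
      ↑((univ : Finset Γ) ×ˢ (S ×ˢ T))) :
    (((univ : Finset Γ) ×ˢ (S ×ˢ T)).image fun p => p.1 • (p.2.1 - p.2.2)).card =
      Fintype.card Γ * (S.card * T.card) := by
  rw [card_image_of_injOn h, card_product, card_product, card_univ]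

/-- The saturated difference set `{k • (s − t) : k ∈ Γ, s ∈ S, t ∈ T}` is `Γ`-invariant. -/
theorem smul_mem_image_smul_sub (S T : Finset H) (g : Γ) {x : H}
    (hx : x ∈ ((univ : Finset Γ) ×ˢ (S ×ˢ T)).image fun p => p.1 • (p.2.1 - p.2.2)) :
    g • x ∈ ((univ : Finset Γ) ×ˢ (S ×ˢ T)).image fun p => p.1 • (p.2.1 - p.2.2) := by
  rw [mem_image] at hx ⊢
  obtain ⟨⟨k, s, t⟩, hp, rfl⟩ := hx
  refine ⟨(g * k, s, t), ?_, ?_⟩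
  · simp only [mem_product, mem_univ, true_and] at hp ⊢
    exact hp
  · show (g * k) • (s - t) = g • k • (s - t)
    exact mul_smul g k (s - t)

end InjOn

/-- **Registered stub `stub_orbitLegCard`** of the line's skeleton (crux
stmt-MatrixMultiplication-10595), verbatim: lemma F6 of the Fourier cap — the `Γ`-saturated
difference sets `X = {g • (a − b)}`, `Y = {g • (b − c)}`, `Z = {g • (c − a)}` of an orbit design
have exactly `|Γ|·|A|·|B|`, `|Γ|·|B|·|C|`, `|Γ|·|C|·|A|` elements, and every saturated difference
set is `Γ`-invariant. [new, elementary] -/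
theorem stub_orbitLegCard : ∀ {Γ H : Type} [Group Γ] [Fintype Γ] [AddCommGroup H] [Fintype H] [DecidableEq H] [DistribMulAction Γ H] (A B C : Finset H), A.Nonempty → B.Nonempty → C.Nonempty → TemplateTPP A B C → TwistedSumFree Γ A B C → (((univ : Finset Γ) ×ˢ (A ×ˢ B)).image fun p => p.1 • (p.2.1 - p.2.2)).card = Fintype.card Γ * (A.card * B.card) ∧ (((univ : Finset Γ) ×ˢ (B ×ˢ C)).image fun p => p.1 • (p.2.1 - p.2.2)).card = Fintype.card Γ * (B.card * C.card) ∧ (((univ : Finset Γ) ×ˢ (C ×ˢ A)).image fun p => p.1 • (p.2.1 - p.2.2)).card = Fintype.card Γ * (C.card * A.card) ∧ (∀ (S T : Finset H) (g : Γ), ∀ x ∈ ((univ : Finset Γ) ×ˢ (S ×ˢ T)).image (fun p => p.1 • (p.2.1 - p.2.2)), g • x ∈ ((univ : Finset Γ) ×ˢ (S ×ˢ T)).image (fun p => p.1 • (p.2.1 - p.2.2))) := by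
  intro Γ H _ _ _ _ _ _ A B C hA hB hC hT hTw
  have hAB : Set.InjOn (fun p : Γ × H × H => p.1 • (p.2.1 - p.2.2))
      ↑((univ : Finset Γ) ×ˢ (A ×ˢ B)) :=
    injOn_smul_sub A B (disjoint_image_smul_sub_AB A B C hC hTw)
      (sub_inj_AB_of_templateTPP A B C hC hT)
  have hBC : Set.InjOn (fun p : Γ × H × H => p.1 • (p.2.1 - p.2.2))
      ↑((univ : Finset Γ) ×ˢ (B ×ˢ C)) :=
    injOn_smul_sub B C (disjoint_image_smul_sub_BC A B C hA hTw)
      (sub_inj_BC_of_templateTPP A B C hA hT)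
  have hCA : Set.InjOn (fun p : Γ × H × H => p.1 • (p.2.1 - p.2.2))
      ↑((univ : Finset Γ) ×ˢ (C ×ˢ A)) :=
    injOn_smul_sub_swap A C (injOn_smul_sub A C (disjoint_image_smul_sub_AC A B C hB hTw)
      (sub_inj_AC_of_templateTPP A B C hB hT))
  exact ⟨card_image_smul_sub A B hAB, card_image_smul_sub B C hBC, card_image_smul_sub C A hCA,
    fun S T g x hx => smul_mem_image_smul_sub S T g hx⟩

end Summit.MatrixMultiplication.MatrixMultiplication.Theorems.ThinPackings.Orbit
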